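import Summits.BirchSwinnertonDyer.Rank1Residual.Additive.KatoDescentTorsionFree
import Summits.BirchSwinnertonDyer.BirchSwinnertonDyer.Theorems.RamifiedSevenEllipticUnitsRubinFormulaZpBsdp
import Summits.BirchSwinnertonDyer.BirchSwinnertonDyer.Theses.RamifiedSevenEllipticUnits
import Summits.BirchSwinnertonDyer.BirchSwinnertonDyer.Theorems.RamifiedSevenEllipticUnitsSevenTorsionLocal
import Literature.NumberTheory.EllipticCurves.AnomalousOfRationalTorsionProofs
import Literature.NumberTheory.EllipticCurves.ComplexMultiplicationNotSemistable
import Literature.NumberTheory.EllipticCurves.BSDSelmerSkinnerProofs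
import Literature.NumberTheory.EllipticCurves.IsogenyHasCMIffJMemProofs
import HarnessLib

set_option linter.dupNamespace false
set_option autoImplicit false

/-!
# Route `RamifiedSevenEllipticUnits` (rung K7r), Value crux `EllipticUnitValueSevenOfGZK`
# (stmt-BirchSwinnertonDyer-19945) in KATO–PERRIN-RIOU CURRENCY: the crux ⟸ KMC(T₇W) ∧ PR^×(W, 7) on
# 𝒞₇ (image-free Kato descent of cell `bsd-potss`), and — GRANTED KMC on 𝒞₇ and the route's residual
# `EllipticUnitIMCSevenZp` (19944) — the crux ⟺ PR^× on 𝒞₇ (helper `--supports` 19945; cell `bsd-cm`,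
# line owner `bsd-cm-k7r-c4` g9, planner D137 (b) «OPTIONAL Theorems-side conditional record»; THEOREMS
# ONLY over the potss interface binder; nothing asserted, no stub registered, no item closed)

WHY THIS FILE. The planner named the research residue of the registered stub `S_arch` of the line
`rubin-formula-zp` (skeleton v4 `069d93eb8845d228`) PR^× = `Additive.PerrinRiouUpToUnitAt` — Perrin-Riou's
Kato-point formula UP TO A `7`-ADIC UNIT at the ADDITIVE (CM-ramified) prime `7` of the twists
`E_D = 49a1^{(D)}`, `D ∈ 𝒞₇` (D132/D133; seat ram g10's THEOREM R, referee g42 desk PASS; LAW RRF 33/33).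
D136 (b) asked for a registered ∀-schema stub over the interface `PRRatio`; D137 RETRACTED it after a
junk-instance audit which this seat reached independently (STATUS 2026-08-27T05:11Z: `PRRatio := ⊥`
passes every reading vacuously and turns `PerrinRiouUpToUnitAt ⊥ W 7` into `W.analyticRank ≠ 1`, which
EMPTIES 𝒞₇; `PRRatio := (· = 1)` gives «`7 ∤ #Ш(E_D)` for every `D`»; with realisability the schema is
`BSD(·, 7)` on 𝒞₇ by Burns–Kurihara–Sano Thm. 7.3) — so PR^× can be a stub only over a CLOSED ratio
predicate (the D-O6-2 construction lane). What the tree CAN hold today is the SOUND downstream use, as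
in cell bsd-potss's part 8b and rung K8's `…CccOneLawOnTypeIstarZeroOfKMCPerrinRiou` (k8i-c2 g4,
p447913): the interface slots `IsOf`, `PRRatio`, `KMC` are section variables USED ONLY AS HYPOTHESES.
This file is the K7r twin of that K8 record:

* §0 the side conditions of the image-free descent on 𝒞₇, UNCONDITIONALLY: additive at `7` (CM and bad),
  `0 ≤ v₇(j)` (CM `j`-invariants are integers), and **`7 ∤ #W(ℚ)_tors` for every curve with CM field
  `ℚ(√−7)`** (`not_seven_dvd_torsionOrder_of_cmFieldDiscr_eq_neg_seven`: a rational point of order `7`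
  would be a non-zero `7`-torsion point of `W` over the `7`-adic completion of `ℚ`, excluded by seat
  k7r-c3's `7`-adic Newton-polygon theorem `SevenTorsion.seven_nsmul_eq_zero_of_valuation`);
* §1 `bsdp_seven_of_kmc_of_perrinRiou` — `BSD(W, 7)` at every `W ∈ 𝒞₇` from KMC(T₇W) ∧ PR^×(W, 7)
  (potss `TorsionFree.rankOne_missingPPartAt_of_kmc_of_perrinRiou` = BKS Thm. 7.6 at `r = 1` in Kato's
  `𝐇²`-formalism, image-free: `W[7]` IS reducible on 𝒞₇ — the `𝔭`-isogeny — so the (12.5.2) versions do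
  not apply; the torsion-free versions need only §0);
* §2 `indexLawAtZp_seven_of_kmc_of_perrinRiou`, `rubinFormulaAtZp_seven_of_kmc_of_perrinRiou` — hence the
  crux body `X12.O11.RamifiedCMBottomClassIndexLawAtZp W 7` and the body of the registered FIT WITNESS
  `stub_rubinFormulaSevenZp` (`X12.O11.RamifiedCMRubinFormulaAtZp W 7`, S_open) at every member (k7r-c3
  g7's `RubinFormulaZpBsdp.…_of_bsdp`: `BSD(W, p) ⟹` the value law, Cassels + modularity + GZK only);
* §3 **`valueSevenOfGZK_of_kmc_of_perrinRiou`** — THE CRUX BY NAME ⟸ (image-free readings 1″♭ / 3♭ +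
  the interface lemma) ∧ (∀ W ∈ 𝒞₇, KMC W 7) ∧ (∀ W ∈ 𝒞₇, PR^×(W, 7)) ∧ Cassels ∧ modularity — ONE
  conditional record; and `rubinFormulaSevenZp_of_kmc_of_perrinRiou`, the same for the registered fit
  witness's exact signature;
* §4 `perrinRiou_seven_of_indexLawAtZp_of_imcZp_of_kmc` (BKS Thm. 7.3: the crux body at `W` + the
  residual (R-IMC)∃-Zp at `W` + KMC ⟹ PR^×(W, 7)) and **`valueSevenOfGZK_iff_perrinRiouOnClassCSeven`** —
  GRANTED KMC(T₇W) on 𝒞₇, the residual `EllipticUnitIMCSevenZp` (stmt-BirchSwinnertonDyer-19944), the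
  readings and {modularity, GZ I.(7.3), GZK, Cassels}: `EllipticUnitValueSevenOfGZK ↔ ∀ W ∈ 𝒞₇, PR^×(W, 7)`.
  Kernel form of the cell sentence «CornerF O10 and O11 hinge on ONE conjecture» (RRF-ram-g10.md §0 item 5;
  K8's §4 is the O10 half).

RELATION TO THEOREM R (RRF-ram-g10.md §1, referee g42 PASS as a conditional derivation). THEOREM R reaches
S_open from PR^×(E_D,7) ∧ PR^×(E_{−11},7) through [BKNO] Thm. 1.8 at `𝟙` (R2), the local period
comparison (R3) and the Kato/elliptic-unit comparison (R4) — a BKNO-INTERNAL transfer for which the tree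
has no object (no `z^{Kato}`, no closed `PRRatio`: D-O6-2). The record below replaces that transfer by
KATO'S OWN main conjecture KMC(T₇W) (Conj. 12.10, with its integrality clause — readings 3♭) and goes
through `BSD(W, 7)` (BKS Thm. 7.6 / 7.3), which the tree holds over the potss interface; the base member
and (R0)/(R1) are then not needed. Both routes name the SAME open input PR^×(·, 7) at an additive prime —
in no source (BKNO §1.4 «report elsewhere»; BSTW 2024 Thm. 6.4 needs `p ∤ 2N`; BKO 2024 inert GOOD `p`;
Rubin 1992 split `p`).

HONEST LABEL: every statement is CONDITIONAL on displayed hypotheses; nothing about Kato's Main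
Conjecture, Perrin-Riou's conjecture, the elliptic-unit IMC or BSD is asserted; no definition, no
Literature statement, no named fact is minted; the crux is concluded BY NAME (§3), never restated; the
registered skeleton v4 is untouched (this is NOT a stub); 19945 and 19944 stay OPEN; BSD is not proved
for any curve by any of this.
[cite: BurnsKuriharaSano2019, Thm. 7.3 and Thm. 7.6 (p. 29)] [cite: Kato2004Asterisque, Conj. 12.10 (p. 224), §14.14 (p. 243), §15]
[cite: PerrinRiou1993AIF, §3.3] [cite: BurungaleKobayashiNakamuraOta2026, §1.4 and Thm. 7.2 (arXiv:2608.06879 pp. 8, 41; shape only)]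
[cite: Miller2011LMS, §1 and Def. 1.1] [cite: SilvermanAEC2009, Exercise 3.7, VII.3 Prop. 3.1]
-/

noncomputable section

open scoped Classical NumberField

open WeierstrassCurve NumberField IsDedekindDomain IsDedekindDomain.HeightOneSpectrum WithZero
open Literature.NumberTheory.EllipticCurves
open Literature.NumberTheory.EllipticCurves.Rank1Residual
open Literature.NumberTheory.EllipticCurves.Rank1Residual.Typed
open Literature.NumberTheory.EllipticCurves.BurungaleKobayashiNakamuraOta2026
open Summit.BirchSwinnertonDyer.Rank1Residual
open Summit.BirchSwinnertonDyer.Rank1Residual.Additive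
open Summit.BirchSwinnertonDyer.Rank1Residual.X12.O11
open Summit.BirchSwinnertonDyer.BirchSwinnertonDyer.Theses.RamifiedSevenEllipticUnits

namespace Summit.BirchSwinnertonDyer.BirchSwinnertonDyer.Theorems.RamifiedSevenEllipticUnits

namespace ValueOfKMCPerrinRiou

/-! ## §0 The side conditions of the image-free descent on 𝒞₇ (unconditional) -/

section SideConditions

variable (W : WeierstrassCurve ℚ) [W.IsElliptic]

/-- **No rational `7`-torsion on a curve with CM field `ℚ(√−7)`: `7 ∤ #W(ℚ)_tors`.** A rational point
of order `7` (Cauchy in the finite group `W(ℚ)_tors`, tree `exists_addOrderOf_eq_of_dvd_torsionOrder`)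
maps injectively (`Affine.Point.map_injective`) to a NON-ZERO point `R` of `W` over the completion `F` of
`ℚ` at the place `(7)` with `7R = O`; but over any valued field with `exp(−2) ≤ v(7) < 1`, `v(ℤ) ≤ 1` and
the two Bézout units, a curve with `j ∈ {−3375, 255³}` (= CM field discriminant `−7`, tree
`X12.j_eq_of_cmFieldDiscrOfJ_eq_neg_seven`) has no such point (seat k7r-c3's
`SevenTorsion.seven_nsmul_eq_zero_of_valuation`: the `7`-adic Newton polygon of `ψ₇` has no slope in
`½ℤ`). Here `v(7) = exp(−1)`. Consequence used below: the image-free potss descent applies at `(W, 7)`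
for every `W ∈ 𝒞₇` although `W[7]` is reducible there. [cite: SilvermanAEC2009, Exercise 3.7 and VII.3 Prop. 3.1] -/
theorem not_seven_dvd_torsionOrder_of_cmFieldDiscr_eq_neg_seven (hj : cmFieldDiscrOfJ W.j = -7) :
    ¬ 7 ∣ W.torsionOrder := by
  intro hdvd
  haveI : Fact (Nat.Prime 7) := ⟨by norm_num⟩
  obtain ⟨T, hT⟩ := exists_addOrderOf_eq_of_dvd_torsionOrder W 7 hdvd
  -- the place `(7)` of `𝓞 ℚ`
  have h7p : Prime (7 : 𝓞 ℚ) := SevenTorsion.prime_seven_ringOfIntegers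
  let v : HeightOneSpectrum (𝓞 ℚ) :=
    ⟨Ideal.span {(7 : 𝓞 ℚ)}, (Ideal.span_singleton_prime h7p.ne_zero).mpr h7p, by
      rw [Ne, Ideal.span_singleton_eq_bot]; exact h7p.ne_zero⟩
  have h7 : (7 : 𝓞 ℚ) ∈ v.asIdeal := Ideal.mem_span_singleton_self _
  -- the valued field `F = ℚ_(7)` and the four valuation conditions
  let F := v.adicCompletion ℚ
  have h7v : Valued.v (7 : F) = v.intValuation (7 : 𝓞 ℚ) := by
    have := SevenTorsion.valued_adicCompletion_intCast v 7
    push_cast at this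
    exact this
  have h71 : Valued.v (7 : F) < 1 := by
    rw [h7v]; exact (intValuation_lt_one_iff_mem v _).mpr h7
  have h72 : exp (-2) ≤ Valued.v (7 : F) := by
    rw [h7v, intValuation_singleton v h7p.ne_zero rfl, exp_le_exp]; omega
  have hint : ∀ n : ℤ, Valued.v ((n : ℤ) : F) ≤ 1 := fun n ↦ by
    rw [SevenTorsion.valued_adicCompletion_intCast]; exact intValuation_le_one v _
  have hm₁ : Valued.v ((4619410991 : ℤ) : F) = 1 := by
    rw [SevenTorsion.valued_adicCompletion_intCast]
    exact SevenTorsion.intValuation_eq_one_of_bezout v h7 (b := 659915856) (by norm_num)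
  have hm₂ : Valued.v ((-368129040996985381009 : ℤ) : F) = 1 := by
    rw [SevenTorsion.valued_adicCompletion_intCast]
    exact SevenTorsion.intValuation_eq_one_of_bezout v h7 (b := -52589862999569340144) (by norm_num)
  -- the image of `T` in `W(F)` is a non-zero point killed by `7`
  let ι : W.toAffine.Point →+ (W.baseChange F).toAffine.Point :=
    Affine.Point.map (W' := W.toAffine) (S := ℚ) (Algebra.ofId ℚ F)
  have hι : Function.Injective ι :=
    Affine.Point.map_injective (W' := W.toAffine) (f := Algebra.ofId ℚ F)
  have hord : addOrderOf (ι T) = 7 := (addOrderOf_injective ι hι T).trans hT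
  have h7R : 7 • ι T = 0 := by
    have h := addOrderOf_nsmul_eq_zero (ι T)
    rwa [hord] at h
  have hR0 : ι T ≠ 0 := fun h0 ↦ by
    rw [h0, addOrderOf_zero] at hord
    exact absurd hord (by norm_num)
  exact hR0 (SevenTorsion.seven_nsmul_eq_zero_of_valuation Valued.v h71 h72 hint hm₁ hm₂ W
    (X12.j_eq_of_cmFieldDiscrOfJ_eq_neg_seven hj) (algebraMap ℚ F) (ι T) h7R)

/-- **On 𝒞₇: `7 ∤ #W(ℚ)_tors`** (CM field discriminant `−7` is a conjunct of `X12.ClassCSeven`).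
[cite: SilvermanAEC2009, Exercise 3.7 and VII.3 Prop. 3.1] -/
theorem not_seven_dvd_torsionOrder [W.IsGloballyMinimal] [Fact (Nat.Prime 7)]
    (h7 : X12.ClassCSeven W) : ¬ 7 ∣ W.torsionOrder :=
  not_seven_dvd_torsionOrder_of_cmFieldDiscr_eq_neg_seven W h7.2.1

/-- **On 𝒞₇: `W` is ADDITIVE at `7`** (bad: CM and `7` ramified in the CM field, tree
`X12.ClassCSeven.not_good_seven`; never multiplicative: a CM curve, tree `not_mult_of_hasCM`).
[cite: SilvermanATAEC1994, Thm. II.6.4 (PDF p. 148)] -/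
theorem addv_seven [W.IsGloballyMinimal] [Fact (Nat.Prime 7)] (h7 : X12.ClassCSeven W) : Addv W 7 :=
  ⟨X12.ClassCSeven.not_good_seven h7, not_mult_of_hasCM W h7.1 7⟩

/-- **On 𝒞₇: `0 ≤ v₇(j(W))`** (a rational CM `j`-invariant is an integer: tree `hasCM_iff_j_mem_holds` +
`exists_int_cast_eq_of_mem_cmJInvariants`). [cite: SilvermanAEC2009, App. C §11, Examples 11.3.1–11.3.2] -/
theorem padicValRat_j_nonneg [W.IsGloballyMinimal] [Fact (Nat.Prime 7)] (h7 : X12.ClassCSeven W) :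
    0 ≤ padicValRat 7 W.j := by
  obtain ⟨n, hn⟩ :=
    exists_int_cast_eq_of_mem_cmJInvariants ((WeierstrassCurve.hasCM_iff_j_mem_holds W).mp h7.1)
  rw [← hn, padicValRat.of_int]
  exact Int.natCast_nonneg _

end SideConditions

section Descent

variable {IsOf : ∀ (W : WeierstrassCurve ℚ) [W.IsElliptic] [W.IsGloballyMinimal] (p : ℕ) [Fact p.Prime],
  KatoDescentDatum p → Prop}
variable {PRRatio : ∀ (W : WeierstrassCurve ℚ) [W.IsElliptic] [W.IsGloballyMinimal] (p : ℕ)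
  [Fact p.Prime], ℚ_[p] → Prop}
variable {KMC : ∀ (W : WeierstrassCurve ℚ) [W.IsElliptic] [W.IsGloballyMinimal] (p : ℕ), Prop}

/-! ## §1 `BSD(W, 7)` at every `W ∈ 𝒞₇` from KMC(T₇W) ∧ PR^×(W, 7) -/

/-- **`BSD(W, 7)` at a member of 𝒞₇ from KMC(T₇W) ∧ PR^×(W, 7)** — the potss image-free rank-one
descent `TorsionFree.rankOne_missingPPartAt_of_kmc_of_perrinRiou` (Burns–Kurihara–Sano Thm. 7.6 at
`r = 1` in Kato's `𝐇²`-formalism, no image hypothesis — `W[7]` is reducible on 𝒞₇), its side conditions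
discharged by §0, then `bsdp_of_missingPPartAt` (GZK). CONDITIONAL on the readings, GZK, modularity, KMC
and PR^× at the pair; nothing booked. [cite: BurnsKuriharaSano2019, Thm. 7.6 (p. 29)] [cite: Kato2004Asterisque, Conj. 12.10 (p. 224)] -/
theorem bsdp_seven_of_kmc_of_perrinRiou (hC : TorsionFree.RankOneCountReading IsOf PRRatio)
    (hreal : TorsionFree.RealizableOfKMC IsOf KMC) (hread : ReadsTrivialKMC IsOf KMC)
    (hGZK : rank_eq_analyticRank_of_analyticRank_le_one) (hmod : hasEntireLFunction_rat)
    (W : WeierstrassCurve ℚ) [W.IsElliptic] [W.IsGloballyMinimal] [Fact (Nat.Prime 7)]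
    (h7 : X12.ClassCSeven W) (hKMC : KMC W 7) (hPR : PerrinRiouUpToUnitAt PRRatio W 7) : BSDp W 7 :=
  bsdp_of_missingPPartAt W 7 hGZK (le_of_eq h7.2.2.1)
    (TorsionFree.rankOne_missingPPartAt_of_kmc_of_perrinRiou W 7 hC hreal hread hGZK hmod h7.2.2.1
      (by norm_num) (addv_seven W h7) (padicValRat_j_nonneg W h7) (not_seven_dvd_torsionOrder W h7)
      hPR hKMC)

/-! ## §2 The crux body and the registered fit witness's body at every member -/

/-- **The crux body `X12.O11.RamifiedCMBottomClassIndexLawAtZp W 7` (the corrected value law (★_an)♯: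
`c = n + n' + ord₇ #Ш_an(W) + ord₇ #Ш_an(W')` for every pinned elliptic-unit datum with the IMC identity)
at a member of 𝒞₇ from KMC(T₇W) ∧ PR^×(W, 7)** — §1 followed by k7r-c3 g7's seam
`RubinFormulaZpBsdp.ramifiedCMBottomClassIndexLawAtZp_of_bsdp` (`BSD(W, 7) ⟹` the value law; Cassels,
modularity, GZK only). CONDITIONAL; nothing booked. [cite: BurnsKuriharaSano2019, Thm. 7.6 (p. 29)]
[cite: Miller2011LMS, Def. 1.1 (arXiv:1010.2431 p. 3)] [cite: Cassels1965ArithmeticVIII] -/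
theorem indexLawAtZp_seven_of_kmc_of_perrinRiou (hC : TorsionFree.RankOneCountReading IsOf PRRatio)
    (hreal : TorsionFree.RealizableOfKMC IsOf KMC) (hread : ReadsTrivialKMC IsOf KMC)
    (hGZK : rank_eq_analyticRank_of_analyticRank_le_one) (hmod : hasEntireLFunction_rat)
    (hCassels : bsdRHS_eq_of_isIsogenous)
    (W : WeierstrassCurve ℚ) [W.IsElliptic] [W.IsGloballyMinimal] [Fact (Nat.Prime 7)]
    (h7 : X12.ClassCSeven W) (hKMC : KMC W 7) (hPR : PerrinRiouUpToUnitAt PRRatio W 7) :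
    RamifiedCMBottomClassIndexLawAtZp W 7 :=
  RubinFormulaZpBsdp.ramifiedCMBottomClassIndexLawAtZp_of_bsdp hCassels hmod hGZK (le_of_eq h7.2.2.1)
    (bsdp_seven_of_kmc_of_perrinRiou hC hreal hread hGZK hmod W h7 hKMC hPR)

/-- **The body `X12.O11.RamifiedCMRubinFormulaAtZp W 7` of the registered FIT WITNESS
`stub_rubinFormulaSevenZp` (S_open: the analytic ramified Rubin formula `λ₀ = 2(n + n') + ord₇ q + ord₇ q'`)
at a member of 𝒞₇ from KMC(T₇W) ∧ PR^×(W, 7)** — §1 and `RubinFormulaZpBsdp.ramifiedCMRubinFormulaAtZp_of_bsdp`.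
So in Kato–Perrin-Riou currency the two registered stubs S_pkg ∧ S_arch of skeleton v4 are jointly
REPLACED by KMC ∧ PR^× at the member (both research inputs at an additive prime). CONDITIONAL.
[cite: BurnsKuriharaSano2019, Thm. 7.6 (p. 29)] [cite: BurungaleKobayashiNakamuraOta2026, Thm. 7.2 and §1.4 (arXiv:2608.06879 pp. 8, 41; shape only)] -/
theorem rubinFormulaAtZp_seven_of_kmc_of_perrinRiou (hC : TorsionFree.RankOneCountReading IsOf PRRatio)
    (hreal : TorsionFree.RealizableOfKMC IsOf KMC) (hread : ReadsTrivialKMC IsOf KMC)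
    (hGZK : rank_eq_analyticRank_of_analyticRank_le_one) (hmod : hasEntireLFunction_rat)
    (hCassels : bsdRHS_eq_of_isIsogenous)
    (W : WeierstrassCurve ℚ) [W.IsElliptic] [W.IsGloballyMinimal] [Fact (Nat.Prime 7)]
    (h7 : X12.ClassCSeven W) (hKMC : KMC W 7) (hPR : PerrinRiouUpToUnitAt PRRatio W 7) :
    RamifiedCMRubinFormulaAtZp W 7 :=
  RubinFormulaZpBsdp.ramifiedCMRubinFormulaAtZp_of_bsdp hCassels hmod hGZK (le_of_eq h7.2.2.1)
    (bsdp_seven_of_kmc_of_perrinRiou hC hreal hread hGZK hmod W h7 hKMC hPR)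

/-! ## §3 THE CRUX BY NAME from KMC ∧ PR^× on 𝒞₇ (ONE conditional record) -/

/-- **Crux 19945 `EllipticUnitValueSevenOfGZK` ⟸ KMC(T₇W) ∧ PR^×(W, 7) at every `W ∈ 𝒞₇`** — over the
image-free readings 1″♭ / 3♭ and the interface lemma of cell bsd-potss, Cassels and modularity (GZK is
the crux's own antecedent). The crux is concluded BY NAME. This is the Kato–Perrin-Riou currency of the
line `rubin-formula-zp`: its research residue (S_arch, named PR^× by D132/D133) AND its PRE-laden package
S_pkg are together implied by {KMC, PR^×} on the class — PR^×(·, 7) at the additive prime `7` being in no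
source (BKNO §1.4 «report elsewhere»; BSTW 2024 needs `p ∤ 2N`). CONDITIONAL on displayed hypotheses;
the interface slots `IsOf`/`PRRatio`/`KMC` are used only as hypotheses (sound for every instance, in
particular the intended one); nothing booked; 19945 stays OPEN.
[cite: BurnsKuriharaSano2019, Thm. 7.6 (p. 29)] [cite: Kato2004Asterisque, Conj. 12.10 (p. 224), §15]
[cite: PerrinRiou1993AIF, §3.3] [cite: Cassels1965ArithmeticVIII] -/
theorem valueSevenOfGZK_of_kmc_of_perrinRiou (hC : TorsionFree.RankOneCountReading IsOf PRRatio)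
    (hreal : TorsionFree.RealizableOfKMC IsOf KMC) (hread : ReadsTrivialKMC IsOf KMC)
    (hmod : hasEntireLFunction_rat) (hCassels : bsdRHS_eq_of_isIsogenous)
    (hKMC : ∀ (W : WeierstrassCurve ℚ) [W.IsElliptic] [W.IsGloballyMinimal] [Fact (Nat.Prime 7)],
      X12.ClassCSeven W → KMC W 7)
    (hPR : ∀ (W : WeierstrassCurve ℚ) [W.IsElliptic] [W.IsGloballyMinimal] [Fact (Nat.Prime 7)],
      X12.ClassCSeven W → PerrinRiouUpToUnitAt PRRatio W 7) :
    EllipticUnitValueSevenOfGZK :=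
  fun hGZK W _ _ _ h7 ↦ indexLawAtZp_seven_of_kmc_of_perrinRiou hC hreal hread hGZK hmod hCassels W h7
    (hKMC W h7) (hPR W h7)

/-- **The registered fit witness `stub_rubinFormulaSevenZp` — its EXACT signature — from KMC ∧ PR^× on
𝒞₇** (and GZK, Cassels, modularity, the readings). Shows what a Kato-currency re-cut of the skeleton
would look like: ONE research stub «∀ W ∈ 𝒞₇, KMC W 7 ∧ PR^×(W, 7)» in place of S_pkg ∧ S_arch — not
registrable over the bare interface (D137), recorded here as a theorem. CONDITIONAL.
[cite: BurnsKuriharaSano2019, Thm. 7.6 (p. 29)] [cite: BurungaleKobayashiNakamuraOta2026, §1.4 (arXiv:2608.06879 p. 8; shape only)] -/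
theorem rubinFormulaSevenZp_of_kmc_of_perrinRiou (hC : TorsionFree.RankOneCountReading IsOf PRRatio)
    (hreal : TorsionFree.RealizableOfKMC IsOf KMC) (hread : ReadsTrivialKMC IsOf KMC)
    (hGZK : rank_eq_analyticRank_of_analyticRank_le_one) (hmod : hasEntireLFunction_rat)
    (hCassels : bsdRHS_eq_of_isIsogenous)
    (hKMC : ∀ (W : WeierstrassCurve ℚ) [W.IsElliptic] [W.IsGloballyMinimal] [Fact (Nat.Prime 7)],
      X12.ClassCSeven W → KMC W 7)
    (hPR : ∀ (W : WeierstrassCurve ℚ) [W.IsElliptic] [W.IsGloballyMinimal] [Fact (Nat.Prime 7)],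
      X12.ClassCSeven W → PerrinRiouUpToUnitAt PRRatio W 7) :
    ∀ (W : WeierstrassCurve ℚ) [W.IsElliptic] [W.IsGloballyMinimal] [Fact (Nat.Prime 7)],
      X12.ClassCSeven W → X12.O11.RamifiedCMRubinFormulaAtZp W 7 :=
  fun W _ _ _ h7 ↦ rubinFormulaAtZp_seven_of_kmc_of_perrinRiou hC hreal hread hGZK hmod hCassels W h7
    (hKMC W h7) (hPR W h7)

/-! ## §4 Conversely (BKS Thm. 7.3): the crux + the residual (R-IMC)∃-Zp + KMC on 𝒞₇ ⟹ PR^× on 𝒞₇ -/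

/-- **PER MEMBER: the crux body at `W` ∧ (R-IMC)∃-Zp at `W` ∧ KMC(T₇W) ⟹ PR^×(W, 7).** The crux body
gives `BSD(W, 7)` modulo the residual and {modularity, GZ I.(7.3), GZK, Cassels} (k7r-c3 g7's
`RubinFormulaZpBsdp.bsdp_of_ramifiedCMBottomClassIndexLawAtZp_of_imcZp`), `BSD(W, 7)` gives
`MissingPPartAt W 7` (`Ш(W)` finite by GZK), and Burns–Kurihara–Sano Thm. 7.3 at `r = 1` over the readings
1″♭ / 3♭ / 4♭ (potss `TorsionFree.perrinRiouUpToUnitAt_of_kmc_of_missingPPartAt`) gives PR^×; side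
conditions by §0. CONDITIONAL; nothing booked. [cite: BurnsKuriharaSano2019, Thm. 7.3 (p. 29)]
[cite: Miller2011LMS, §1 and Def. 1.1] [cite: GrossZagier1986, Thm. I.(7.3)] -/
theorem perrinRiou_seven_of_indexLawAtZp_of_imcZp_of_kmc
    (hC : TorsionFree.RankOneCountReading IsOf PRRatio) (hrat : TorsionFree.HasPRRatio PRRatio)
    (hreal : TorsionFree.RealizableOfKMC IsOf KMC) (hread : ReadsTrivialKMC IsOf KMC)
    (hGZK : rank_eq_analyticRank_of_analyticRank_le_one) (hmod : hasEntireLFunction_rat)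
    (hGZ : GrossZagier1986_thm_I_7_3) (hCassels : bsdRHS_eq_of_isIsogenous)
    (W : WeierstrassCurve ℚ) [W.IsElliptic] [W.IsGloballyMinimal] [Fact (Nat.Prime 7)]
    (h7 : X12.ClassCSeven W) (h1 : RamifiedCMEllipticUnitIMCAtZp W 7) (hKMC : KMC W 7)
    (h2 : RamifiedCMBottomClassIndexLawAtZp W 7) : PerrinRiouUpToUnitAt PRRatio W 7 := by
  have hB : BSDp W 7 :=
    RubinFormulaZpBsdp.bsdp_of_ramifiedCMBottomClassIndexLawAtZp_of_imcZp hmod hGZ hGZK hCassels h1 h7.1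
      (X12.ClassCSeven.cmRamified_seven h7) (by norm_num) h7.2.2.1 h2
  haveI : Finite W.sha := (hGZK W (le_of_eq h7.2.2.1)).2
  exact TorsionFree.perrinRiouUpToUnitAt_of_kmc_of_missingPPartAt W 7 hC hrat hreal hread hGZK hmod
    h7.2.2.1 (by norm_num) (addv_seven W h7) (padicValRat_j_nonneg W h7) (not_seven_dvd_torsionOrder W h7)
    hKMC (missingPPartAt_of_bsdp W 7 hB)

/-- **THE CRUX, the residual 19944 and KMC(T₇W) on 𝒞₇ GIVE PR^×(W, 7) at every `W ∈ 𝒞₇`** (crux by name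
⟹ its body at `W` under GZK, then the per-member triangle). CONDITIONAL; nothing booked.
[cite: BurnsKuriharaSano2019, Thm. 7.3 (p. 29)] [cite: BurungaleKobayashiNakamuraOta2026, Thm. 3.14 (3) and §1.4 (arXiv:2608.06879; shape only)] -/
theorem perrinRiouOnClassCSeven_of_valueSevenOfGZK_of_imcZp_of_kmc
    (hC : TorsionFree.RankOneCountReading IsOf PRRatio) (hrat : TorsionFree.HasPRRatio PRRatio)
    (hreal : TorsionFree.RealizableOfKMC IsOf KMC) (hread : ReadsTrivialKMC IsOf KMC)
    (hGZK : rank_eq_analyticRank_of_analyticRank_le_one) (hmod : hasEntireLFunction_rat)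
    (hGZ : GrossZagier1986_thm_I_7_3) (hCassels : bsdRHS_eq_of_isIsogenous)
    (hKMC : ∀ (W : WeierstrassCurve ℚ) [W.IsElliptic] [W.IsGloballyMinimal] [Fact (Nat.Prime 7)],
      X12.ClassCSeven W → KMC W 7)
    (h1 : EllipticUnitIMCSevenZp) (hV : EllipticUnitValueSevenOfGZK)
    (W : WeierstrassCurve ℚ) [W.IsElliptic] [W.IsGloballyMinimal] [Fact (Nat.Prime 7)]
    (h7 : X12.ClassCSeven W) : PerrinRiouUpToUnitAt PRRatio W 7 :=
  perrinRiou_seven_of_indexLawAtZp_of_imcZp_of_kmc hC hrat hreal hread hGZK hmod hGZ hCassels W h7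
    (h1 W h7) (hKMC W h7) (hV hGZK W h7)

/-- **GRANTED KMC(T₇W) on 𝒞₇ and the residual `EllipticUnitIMCSevenZp` (stmt-BirchSwinnertonDyer-19944)
— and the image-free readings, GZK, modularity, Gross–Zagier I.(7.3), Cassels —:
`EllipticUnitValueSevenOfGZK ↔ ∀ W ∈ 𝒞₇, PR^×(W, 7)`.** Kernel form, on CornerF-ramified@7 × 𝒞₇, of the
cell sentence «the research residue of K7r's Value crux IS Perrin-Riou's conjecture up to a `7`-adic unit
at the additive prime `7` for the twists `E_D` — the node on which K8/O10 (19223) is already blocked;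
CornerF O10 and O11 hinge on ONE conjecture» (seat ram g10, RRF-ram-g10.md §0 (5); planner D132/D133/D137;
K8's half is `CccOneKMCPerrinRiou.cccOneLawOnTypeIstarZero_iff_perrinRiouOnType_of_kmc`). Here modulo KMC
on the Kato side and (R-IMC)∃-Zp on the elliptic-unit side — the tree has no zeta-element object linking
`z(𝟙)` to Kato's class directly (THEOREM R's (R4) is PAPER; D-O6-2). CONDITIONAL; nothing booked; 19945
and 19944 stay OPEN; BSD is not proved for any curve.
[cite: BurnsKuriharaSano2019, Thm. 7.3 and Thm. 7.6 (p. 29)] [cite: Kato2004Asterisque, Conj. 12.10 (p. 224), §15]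
[cite: PerrinRiou1993AIF, §3.3] [cite: BurungaleKobayashiNakamuraOta2026, §1.4 (arXiv:2608.06879 p. 8; shape only)] -/
theorem valueSevenOfGZK_iff_perrinRiouOnClassCSeven
    (hC : TorsionFree.RankOneCountReading IsOf PRRatio) (hrat : TorsionFree.HasPRRatio PRRatio)
    (hreal : TorsionFree.RealizableOfKMC IsOf KMC) (hread : ReadsTrivialKMC IsOf KMC)
    (hGZK : rank_eq_analyticRank_of_analyticRank_le_one) (hmod : hasEntireLFunction_rat)
    (hGZ : GrossZagier1986_thm_I_7_3) (hCassels : bsdRHS_eq_of_isIsogenous)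
    (hKMC : ∀ (W : WeierstrassCurve ℚ) [W.IsElliptic] [W.IsGloballyMinimal] [Fact (Nat.Prime 7)],
      X12.ClassCSeven W → KMC W 7)
    (h1 : EllipticUnitIMCSevenZp) :
    EllipticUnitValueSevenOfGZK ↔
      ∀ (W : WeierstrassCurve ℚ) [W.IsElliptic] [W.IsGloballyMinimal] [Fact (Nat.Prime 7)],
        X12.ClassCSeven W → PerrinRiouUpToUnitAt PRRatio W 7 :=
  ⟨fun hV W _ _ _ h7 ↦ perrinRiouOnClassCSeven_of_valueSevenOfGZK_of_imcZp_of_kmc hC hrat hreal hread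
      hGZK hmod hGZ hCassels hKMC h1 hV W h7,
    fun hPR ↦ valueSevenOfGZK_of_kmc_of_perrinRiou hC hreal hread hmod hCassels hKMC hPR⟩

end Descent

end ValueOfKMCPerrinRiou

end Summit.BirchSwinnertonDyer.BirchSwinnertonDyer.Theorems.RamifiedSevenEllipticUnits

end
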